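import Mathlib
import Literature.Computability.AlgebraicComplexity.RealTauKnownCases
import Summits.ValiantsHypothesis.ValiantsHypothesis.Theorems.LacunarySymmetroidMatrixDescartesStubNegRoots
import Summits.ValiantsHypothesis.ValiantsHypothesis.Theorems.LacunarySymmetroidMatrixDescartesStubDescartesCeiling
import Summits.ValiantsHypothesis.ValiantsHypothesis.Theorems.LacunarySymmetroidMatrixDescartesCommonDirectionFactor

/-!
# `MatrixDescartes` (stmt-ValiantsHypothesis-18050) — the COMMON-DIRECTION LOW-RANK SECTOR, part 3: the JOINT-RANK
# ceiling — a common-direction pencil whose perturbation rows span an `r`-dimensional space counts like a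
# `K`-nomial times an `(r, K)`-format pencil: `Z₊ + 1 ≤ (K − 1) + C(r + K − 1, r)`, size-free

HONEST FRAMING.  Cell `pub-symmetroid`, seat `val-sym-mdr-p2` (gen 18); helper file `--supports` the crux
`Theses.LacunarySymmetroid.MatrixDescartes`, NO closure claim.  It SHARPENS parts 1–2 (`…CommonDirectionFactor`,
`…CommonDirection`, this session): nothing here bears on the crux in its window, on `DoorA26`/`DoorA34`, registers, or
`VP ≠ VNP`.

THE SECTOR.  Letters `Sₗ = cₗ • B + Wₗ` (`l < K`): ONE common real `m × m` matrix `B` (any rank, no symmetry needed) carried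
by an arbitrary `K`-nomial `φ = ∑ₗ C(cₗ) X^{dₗ}`, plus perturbations `Wₗ`.  Let `r` be the JOINT ROW RANK of the
perturbations — the rank of the stacked `(K·m) × m` matrix of all rows of all `Wₗ` (so `r ≤ m` and `r ≤ ∑ₗ rank Wₗ`; e.g.
`r = rank V` when every `Wₗ = Aₗ Vᵀ` factors through one `m × r` matrix `V`).  THEN (`commonDirection_jointRank_ceiling`)

  `Z₊ + 1 ≤ (K − 1) + C(r + K − 1, r)`   — INDEPENDENT of the size `m` and of the number of fat letters,

where `Z₊` counts the distinct positive zeros of `det (∑ₗ X^{dₗ} Sₗ)` and `C(r + K − 1, r) = D(r, K)` is the trivial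
Descartes ceiling of the `(r, K)` format (`stub_descartesCeiling`).  Reading: for zero counting, «common direction modulo
joint rank `r`» IS the format `(r, K)` shifted by the `≤ K − 1` zeros of `φ` (for invertible `B` literally:
`det F = det B · φ^{m−r} · det(∑ₗ X^{dₗ}(cₗ • 1_r + Gₗ))` with `Gₗ = VᵀB⁻¹Aₗ`); part 2's ceiling
`(K − 1) + ∏(rank Wₗ + 1)·C(R + K − 1, K − 1)`, `R = ∑ rank Wₗ ≥ r`, is weaker.  For FIXED `r` the count is POLYNOMIAL in
`K` (`O(K^r)`), at every size.  Two common directions are already size-dependent (`det(α(x)•1 + β(x)•diag(1,…,m))` has up to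
`m(K − 1)` positive zeros), so one common direction is where size-freeness ends in this hierarchy.

PROOF.  As in part 1, `det F = ∑_g φ^{a(g)} X^{e(g)} C(det N_g)` over row choices `g : Fin m → Option (Fin K)`; the rows of
`N_g` chosen from the `Wₗ` are rows of the stacked matrix, so more than `r` of them are dependent
(`det_rowChoice_eq_zero_of_jointRank`), hence **`det F = φ^(m − r) · h`** (`det_pencil_eq_mul_jointRank`).  Every monomial
of `h` is `X^{(sum of (r − w) exponents dₗ, from φ^(r−w))} · X^{(sum of the w exponents d_{g i} of the W-rows)}` — a sum of
EXACTLY `r` exponents with repetition — so `supp h` lies in the image of `Sym (Fin K) r` (`support_hJ_subset`, the tree's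
count-vector lemma `StubDescartesCeiling.support_det_pencil_subset` for the scalar pencil) and `#supp h ≤ C(K + r − 1, r)`.
Sparse Descartes (tree `card_roots_toFinset_filter_pos_lt_card_support`) and part 1's `Z₊(φ^N) ≤ K − 1` finish.  The crux
inequality on the sector (`commonDirection_jointRank_mdr`): joint rank `≤ s·K`, `q·(s + 3) ≤ ⌊log₂K⌋` ⇒ `Z^q ≤ 2^(K⌊log₂K⌋)` at
every size (reflection `Sₗ ↦ (−1)^{dₗ}Sₗ` keeps the joint rank: the stacked matrix is multiplied by an invertible diagonal).
Elementary; axioms `propext`, `Classical.choice`, `Quot.sound`; no definitions (file-local notation).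
-/

-- layout Summits/ValiantsHypothesis/ValiantsHypothesis forces the duplicated namespace component
set_option linter.dupNamespace false

namespace Summit.ValiantsHypothesis.ValiantsHypothesis.Theorems.LacunarySymmetroidMatrixDescartes

open Polynomial Finset
open scoped BigOperators Polynomial

/-- the scalar `K`-nomial `φ = ∑ₗ C(cₗ) X^{dₗ}` carrying the common direction (as in part 1) -/
local notation3 (prettyPrint := false) "φ[" d ", " c "]" =>
  (∑ l, Polynomial.C (c l) * (Polynomial.X : Polynomial ℝ) ^ (d l))

/-- the real matrix `N_g` of a row choice `g` (as in part 1) -/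
local notation3 (prettyPrint := false) "N[" B ", " W ", " g "]" =>
  (Matrix.of fun i j => Option.elim (g i) B W i j)

/-- number of rows in which the row choice `g` picks the piece `o` (as in part 1) -/
local notation3 (prettyPrint := false) "cnt[" g ", " o "]" =>
  (Finset.univ.filter fun i => g i = o).card

/-- the STACKED perturbation matrix: row `(l, i)` is row `i` of `Wₗ` -/
local notation3 (prettyPrint := false) "Wst[" W "]" =>
  (Matrix.of fun (p : Fin _ × Fin _) (j : Fin _) => W p.1 p.2 j)

/-- the joint-rank cofactor `h` of `det F = φ^(m − r) · h` (size `m` and joint rank `r` explicit) -/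
local notation3 (prettyPrint := false) "hJ[" m ", " r ", " d ", " B ", " c ", " W "]" =>
  (∑ g : Fin m → Option (Fin _),
    φ[d, c] ^ (cnt[g, none] - (m - r)) * (Polynomial.X : Polynomial ℝ) ^ (∑ i, (g i).elim 0 d)
      * Polynomial.C (Matrix.det N[B, W, g]))

namespace CommonDirection

variable {K m : ℕ}

/-- The number of `W`-rows of a row choice plus the number of `B`-rows is `m`. [folklore] -/
theorem card_wRows_add_cnt_none (g : Fin m → Option (Fin K)) :
    (univ.filter fun i => g i ≠ none).card + cnt[g, none] = m := by
  have h := Finset.card_filter_add_card_filter_not (s := (univ : Finset (Fin m))) (fun i => g i ≠ none)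
  simp only [not_not, Finset.card_univ, Fintype.card_fin] at h
  exact h

/-- **Joint rank kills over-used perturbation rows**: if a row choice `g` takes more than `rank` (stacked `W`) rows from the
perturbations, then `det N_g = 0` — all those rows lie in the row space of the stacked matrix. [folklore] -/
theorem det_rowChoice_eq_zero_of_jointRank (B : Matrix (Fin m) (Fin m) ℝ) (W : Fin K → Matrix (Fin m) (Fin m) ℝ)
    (g : Fin m → Option (Fin K)) (h : (Wst[W]).rank < (univ.filter fun i => g i ≠ none).card) :
    Matrix.det N[B, W, g] = 0 := by
  apply Matrix.det_eq_zero_of_not_linearIndependent_rows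
  intro hli
  have hsub : LinearIndependent ℝ (fun i : {i // g i ≠ none} => N[B, W, g] i.1) :=
    hli.comp _ Subtype.val_injective
  have hcard := finrank_span_eq_card hsub
  have hrange : Set.range (fun i : {i // g i ≠ none} => N[B, W, g] i.1) ⊆ Set.range (Wst[W]).row := by
    rintro _ ⟨i, rfl⟩
    obtain ⟨l, hl⟩ := Option.ne_none_iff_exists'.1 i.2
    refine ⟨(l, i.1), ?_⟩
    funext j
    simp [Matrix.row, hl]
  have hle : Module.finrank ℝ (Submodule.span ℝ (Set.range fun i : {i // g i ≠ none} => N[B, W, g] i.1))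
      ≤ (Wst[W]).rank := by
    rw [Matrix.rank_eq_finrank_span_row]
    exact Submodule.finrank_mono (Submodule.span_mono hrange)
  rw [hcard, Fintype.card_subtype] at hle
  omega

/-- A surviving row choice (`det N_g ≠ 0`) takes at most `rank` (stacked `W`) rows from the perturbations, hence at least
`m − rank` rows from `B`. [folklore] -/
theorem cnt_none_ge_of_ne_zero_jointRank (B : Matrix (Fin m) (Fin m) ℝ) (W : Fin K → Matrix (Fin m) (Fin m) ℝ)
    (g : Fin m → Option (Fin K)) (h : Matrix.det N[B, W, g] ≠ 0) :
    (univ.filter fun i => g i ≠ none).card ≤ (Wst[W]).rank ∧ m - (Wst[W]).rank ≤ cnt[g, none] := by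
  have h1 : (univ.filter fun i => g i ≠ none).card ≤ (Wst[W]).rank := by
    by_contra hlt
    exact h (det_rowChoice_eq_zero_of_jointRank B W g (not_le.1 hlt))
  have h2 := card_wRows_add_cnt_none g
  exact ⟨h1, by omega⟩

/-- **JOINT-RANK FACTORISATION** `det (∑ₗ X^{dₗ}(cₗ • B + Wₗ)) = φ^(m − r) · h`, `r` = rank of the stacked perturbation matrix.
[folklore] -/
theorem det_pencil_eq_mul_jointRank (d : Fin K → ℕ) (B : Matrix (Fin m) (Fin m) ℝ) (c : Fin K → ℝ)
    (W : Fin K → Matrix (Fin m) (Fin m) ℝ) :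
    Matrix.det (∑ l, ((X : ℝ[X]) ^ d l) • (c l • B + W l).map C) =
      φ[d, c] ^ (m - (Wst[W]).rank) * hJ[m, (Wst[W]).rank, d, B, c, W] := by
  rw [det_pencil_eq_sum, Finset.mul_sum]
  refine Finset.sum_congr rfl fun g _ => ?_
  rw [sum_ind_eq]
  by_cases hz : Matrix.det N[B, W, g] = 0
  · rw [hz, map_zero, mul_zero, mul_zero, mul_zero]
  · have hcnt := (cnt_none_ge_of_ne_zero_jointRank B W g hz).2
    rw [← mul_assoc, ← mul_assoc, ← pow_add, Nat.add_sub_cancel' hcnt]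

/-- The multiset of perturbation letters used by a row choice (each `l` with multiplicity `nₗ(g)`), written via a default
letter `l₀` for the unused `none` case. [folklore] -/
theorem card_wMultiset (l₀ : Fin K) (g : Fin m → Option (Fin K)) :
    Multiset.card (((univ.filter fun i => g i ≠ none).val).map (fun i => (g i).getD l₀))
      = (univ.filter fun i => g i ≠ none).card := by
  rw [Multiset.card_map, Finset.card_val]

/-- The exponent `e(g) = ∑ᵢ d(g i)` is the `d`-sum of the multiset of used perturbation letters. [folklore] -/
theorem sum_map_wMultiset (l₀ : Fin K) (d : Fin K → ℕ) (g : Fin m → Option (Fin K)) :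
    ((((univ.filter fun i => g i ≠ none).val).map (fun i => (g i).getD l₀)).map d).sum = ∑ i, (g i).elim 0 d := by
  rw [Multiset.map_map]
  change ∑ i ∈ univ.filter (fun i => g i ≠ none), (d ∘ fun i => (g i).getD l₀) i = _
  rw [← Finset.sum_filter_add_sum_filter_not univ (fun i => g i ≠ none) (fun i => (g i).elim 0 d)]
  have h0 : ∑ i ∈ univ.filter (fun i => ¬ g i ≠ none), (g i).elim 0 d = 0 :=
    Finset.sum_eq_zero fun i hi => by
      have : g i = none := not_not.1 (Finset.mem_filter.1 hi).2
      rw [this]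
      rfl
  rw [h0, add_zero]
  refine Finset.sum_congr rfl fun i hi => ?_
  obtain ⟨l, hl⟩ := Option.ne_none_iff_exists'.1 (Finset.mem_filter.1 hi).2
  simp [hl]

/-- **Support of the joint-rank cofactor**: every exponent of `h` is a sum of exactly `r` exponents `dₗ` (with repetition) —
the Descartes support of an `(r, K)`-format pencil. [folklore] -/
theorem support_hJ_subset (hK : 0 < K) (d : Fin K → ℕ) (B : Matrix (Fin m) (Fin m) ℝ) (c : Fin K → ℝ)
    (W : Fin K → Matrix (Fin m) (Fin m) ℝ) :
    (hJ[m, (Wst[W]).rank, d, B, c, W]).support ⊆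
      (Finset.univ : Finset (Sym (Fin K) (Wst[W]).rank)).image
        (fun s : Sym (Fin K) (Wst[W]).rank => ((s : Multiset (Fin K)).map d).sum) := by
  set r := (Wst[W]).rank with hr
  have hrm : r ≤ m := by
    have h := Matrix.rank_le_card_width (Wst[W])
    rw [Fintype.card_fin] at h
    exact h
  intro k hk
  rw [mem_support_iff, finsetSum_coeff] at hk
  obtain ⟨g, -, hg⟩ := Finset.exists_ne_zero_of_sum_ne_zero hk
  rw [coeff_mul_C, coeff_mul_X_pow'] at hg
  have hdet : Matrix.det N[B, W, g] ≠ 0 := by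
    intro h0
    exact hg (by rw [h0, mul_zero])
  have hle : (∑ i, (g i).elim 0 d) ≤ k := by
    by_contra hlt
    exact hg (by rw [if_neg hlt, zero_mul])
  rw [if_pos hle] at hg
  set E := cnt[g, none] - (m - r) with hE
  have hcoeff : (φ[d, c] ^ E).coeff (k - ∑ i, (g i).elim 0 d) ≠ 0 := fun h0 => hg (by rw [h0, zero_mul])
  -- the φ-part: a sum of `E` exponents
  have hmemφ : (k - ∑ i, (g i).elim 0 d) ∈ (φ[d, c] ^ E).support := mem_support_iff.2 hcoeff
  rw [← det_scalar_pencil d c E] at hmemφ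
  obtain ⟨s', -, hs'⟩ := Finset.mem_image.1
    (StubDescartesCeiling.support_det_pencil_subset d (fun l => c l • (1 : Matrix (Fin E) (Fin E) ℝ)) hmemφ)
  -- the W-part: the multiset of used letters, of size `w = #W-rows`, with `E + w = r`
  obtain ⟨hw, hcnt⟩ := cnt_none_ge_of_ne_zero_jointRank B W g hdet
  have hm := card_wRows_add_cnt_none g
  set l₀ : Fin K := ⟨0, hK⟩
  set sW : Multiset (Fin K) := ((univ.filter fun i => g i ≠ none).val).map (fun i => (g i).getD l₀) with hsW
  have hcard : Multiset.card ((s' : Multiset (Fin K)) + sW) = r := by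
    rw [Multiset.card_add, Sym.card_coe, hsW, card_wMultiset]
    omega
  refine Finset.mem_image.2 ⟨⟨(s' : Multiset (Fin K)) + sW, hcard⟩, Finset.mem_univ _, ?_⟩
  change (((s' : Multiset (Fin K)) + sW).map d).sum = k
  rw [Multiset.map_add, Multiset.sum_add, hsW, sum_map_wMultiset, hs']
  omega

/-- **Monomial count of the joint-rank cofactor**: `#supp h ≤ C(K + r − 1, r) = D(r, K)`. [folklore] -/
theorem card_support_hJ_le (hK : 0 < K) (d : Fin K → ℕ) (B : Matrix (Fin m) (Fin m) ℝ) (c : Fin K → ℝ)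
    (W : Fin K → Matrix (Fin m) (Fin m) ℝ) :
    (hJ[m, (Wst[W]).rank, d, B, c, W]).support.card ≤ Nat.choose (K + (Wst[W]).rank - 1) (Wst[W]).rank := by
  refine (Finset.card_le_card (support_hJ_subset hK d B c W)).trans (Finset.card_image_le.trans ?_)
  rw [Finset.card_univ, Sym.card_sym_eq_choose, Fintype.card_fin]

end CommonDirection

open CommonDirection in
/-- **COMMON-DIRECTION CEILING, JOINT-RANK FORM (size-free).**  For every `K ≥ 1`, every size `m`, all exponents `d`, every real
`m × m` matrix `B`, all reals `cₗ` and all real `m × m` matrices `Wₗ`, with `r` the rank of the stacked `(K·m) × m` matrix of all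
rows of all `Wₗ`: the lacunary pencil `∑ₗ X^{dₗ}(cₗ • B + Wₗ)` satisfies `Z₊ + 1 ≤ (K − 1) + C(K + r − 1, r)` for the number `Z₊`
of distinct positive zeros of its determinant — the Descartes ceiling of the `(r, K)` format plus the `K − 1` zeros of `φ`,
independently of `m`.  (The determinant `0` has no counted roots.) [folklore] -/
theorem commonDirection_jointRank_ceiling {K m : ℕ} (hK : 0 < K) (d : Fin K → ℕ) (B : Matrix (Fin m) (Fin m) ℝ)
    (c : Fin K → ℝ) (W : Fin K → Matrix (Fin m) (Fin m) ℝ) :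
    ((Matrix.det (∑ l, ((Polynomial.X : Polynomial ℝ) ^ d l) • (c l • B + W l).map Polynomial.C)
        ).roots.toFinset.filter (fun t => 0 < t)).card + 1
      ≤ (K - 1) + Nat.choose (K + (Matrix.of fun (p : Fin K × Fin m) (j : Fin m) => W p.1 p.2 j).rank - 1)
          (Matrix.of fun (p : Fin K × Fin m) (j : Fin m) => W p.1 p.2 j).rank := by
  set r := (Matrix.of fun (p : Fin K × Fin m) (j : Fin m) => W p.1 p.2 j).rank with hr
  have hch : 1 ≤ Nat.choose (K + r - 1) r := Nat.choose_pos (by omega)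
  by_cases hP : Matrix.det (∑ l, ((Polynomial.X : Polynomial ℝ) ^ d l) • (c l • B + W l).map Polynomial.C)
      = 0
  · rw [hP, Polynomial.roots_zero, Multiset.toFinset_zero, Finset.filter_empty, Finset.card_empty,
      zero_add]
    omega
  · rw [CommonDirection.det_pencil_eq_mul_jointRank] at hP ⊢
    have hφ : φ[d, c] ^ (m - r) ≠ 0 := left_ne_zero_of_mul hP
    have hh : hJ[m, r, d, B, c, W] ≠ 0 := right_ne_zero_of_mul hP
    rw [Polynomial.roots_mul hP, Multiset.toFinset_add, Finset.filter_union]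
    have h1 := CommonDirection.card_posRoots_phi_pow_le hK d c _ hφ
    have h2 :=
      Literature.Computability.AlgebraicComplexity.card_roots_toFinset_filter_pos_lt_card_support hh
    have h3 : (hJ[m, r, d, B, c, W]).support.card ≤ Nat.choose (K + r - 1) r := by
      rw [hr]
      exact CommonDirection.card_support_hJ_le hK d B c W
    calc ((φ[d, c] ^ (m - r)).roots.toFinset.filter (fun t => 0 < t) ∪
            (hJ[m, r, d, B, c, W]).roots.toFinset.filter (fun t => 0 < t)).card + 1
        ≤ (((φ[d, c] ^ (m - r)).roots.toFinset.filter (fun t => 0 < t)).card +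
            ((hJ[m, r, d, B, c, W]).roots.toFinset.filter (fun t => 0 < t)).card) + 1 :=
          Nat.add_le_add_right (Finset.card_union_le _ _) 1
      _ ≤ (K - 1) + Nat.choose (K + r - 1) r := by omega

/-- The joint rank never exceeds the size: the joint-rank ceiling is at most the trivial Descartes ceiling `C(m + K − 1, m)` plus
`K − 1`. [folklore] -/
theorem jointRank_le_size {K m : ℕ} (W : Fin K → Matrix (Fin m) (Fin m) ℝ) :
    (Matrix.of fun (p : Fin K × Fin m) (j : Fin m) => W p.1 p.2 j).rank ≤ m := by
  have h := Matrix.rank_le_card_width (Matrix.of fun (p : Fin K × Fin m) (j : Fin m) => W p.1 p.2 j)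
  rw [Fintype.card_fin] at h
  exact h

/-- The reflection `Wₗ ↦ (−1)^{dₗ} Wₗ` multiplies the stacked matrix by an invertible diagonal matrix, so it keeps the joint
rank. [folklore] -/
theorem jointRank_reflect {K m : ℕ} (d : Fin K → ℕ) (W : Fin K → Matrix (Fin m) (Fin m) ℝ) :
    (Matrix.of fun (p : Fin K × Fin m) (j : Fin m) => (((-1 : ℝ) ^ d p.1) • W p.1) p.2 j).rank
      = (Matrix.of fun (p : Fin K × Fin m) (j : Fin m) => W p.1 p.2 j).rank := by
  have hmat : (Matrix.of fun (p : Fin K × Fin m) (j : Fin m) => (((-1 : ℝ) ^ d p.1) • W p.1) p.2 j)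
      = Matrix.diagonal (fun p : Fin K × Fin m => (-1 : ℝ) ^ d p.1)
          * (Matrix.of fun (p : Fin K × Fin m) (j : Fin m) => W p.1 p.2 j) := by
    ext p j
    rw [Matrix.diagonal_mul]
    simp [Matrix.smul_apply]
  rw [hmat]
  refine Matrix.rank_mul_eq_right_of_isUnit_det _ _ ?_
  rw [Matrix.det_diagonal]
  exact isUnit_iff_ne_zero.2 (Finset.prod_ne_zero_iff.2 fun p _ => pow_ne_zero _ (by norm_num))

/-- **The crux's inequality on the joint-rank sector.**  For all `q, s` and every `K ≥ 1` with `q·(s + 3) ≤ ⌊log₂K⌋`, EVERY size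
`m`, all exponents, every real `B`, all reals `cₗ` and all real `Wₗ` whose stacked matrix has rank `≤ s·K` (e.g. every `Wₗ`
factors through one fixed `m × (sK)` matrix), the number `Z` of distinct real zeros of `det (∑ₗ X^{dₗ}(cₗ • B + Wₗ))` satisfies
`Z^q ≤ 2^(K⌊log₂K⌋)` — the inequality of `MatrixDescartes` without its size bound and without symmetry.  Proof:
`(K − 1) + C(K + r − 1, r) ≤ 2^K + 2^((s+1)K)`, twice (pencil and reflection, same joint rank by `jointRank_reflect`) plus the
origin (tree `stub_negRoots`). [folklore] -/
theorem commonDirection_jointRank_mdr (q s K m : ℕ) (hK : q * (s + 3) ≤ Nat.log 2 K) (hK0 : 0 < K)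
    (d : Fin K → ℕ) (B : Matrix (Fin m) (Fin m) ℝ) (c : Fin K → ℝ) (W : Fin K → Matrix (Fin m) (Fin m) ℝ)
    (hr : (Matrix.of fun (p : Fin K × Fin m) (j : Fin m) => W p.1 p.2 j).rank ≤ s * K) :
    (Matrix.det (∑ l, ((Polynomial.X : Polynomial ℝ) ^ d l) •
        (c l • B + W l).map Polynomial.C)).roots.toFinset.card ^ q ≤ 2 ^ (K * Nat.log 2 K) := by
  -- ceiling arithmetic: `(K − 1) + C(K + r − 1, r) ≤ 2^((s+2)K)` whenever `r ≤ sK`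
  have harith : ∀ r : ℕ, r ≤ s * K → (K - 1) + Nat.choose (K + r - 1) r ≤ 2 ^ ((s + 2) * K) := by
    intro r hr'
    have h1 : K - 1 ≤ 2 ^ K := (Nat.sub_le K 1).trans Nat.lt_two_pow_self.le
    have h3 : K + r - 1 ≤ (s + 1) * K := by
      have h4 := Nat.sub_le (K + r) 1
      nlinarith
    have h5 : K ≤ (s + 1) * K := Nat.le_mul_of_pos_left K (Nat.succ_pos s)
    have h6 : (s + 1) * K + 1 ≤ (s + 2) * K := by nlinarith
    have h2 : Nat.choose (K + r - 1) r ≤ 2 ^ ((s + 1) * K) :=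
      (Nat.choose_le_two_pow _ _).trans (Nat.pow_le_pow_right (by norm_num) h3)
    calc (K - 1) + Nat.choose (K + r - 1) r ≤ 2 ^ K + 2 ^ ((s + 1) * K) := Nat.add_le_add h1 h2
      _ ≤ 2 ^ ((s + 1) * K) + 2 ^ ((s + 1) * K) :=
          Nat.add_le_add_right (Nat.pow_le_pow_right (by norm_num) h5) _
      _ = 2 ^ ((s + 1) * K + 1) := by rw [pow_succ]; ring
      _ ≤ 2 ^ ((s + 2) * K) := Nat.pow_le_pow_right (by norm_num) h6
  have hA := (commonDirection_jointRank_ceiling hK0 d B c W).trans (harith _ hr)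
  have hB := (commonDirection_jointRank_ceiling hK0 d B (fun l => (-1 : ℝ) ^ d l * c l)
    (fun l => ((-1 : ℝ) ^ d l) • W l)).trans (harith _ (by
      have e : (Matrix.of fun (p : Fin K × Fin m) (j : Fin m) => (((-1 : ℝ) ^ d p.1) • W p.1) p.2 j).rank
          = (Matrix.of fun (p : Fin K × Fin m) (j : Fin m) => W p.1 p.2 j).rank := jointRank_reflect d W
      rw [e]; exact hr))
  have hZ := stub_negRoots K m d (fun l => c l • B + W l)
  have hreflsum : (∑ l, ((Polynomial.X : Polynomial ℝ) ^ d l) •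
        (((-1 : ℝ) ^ d l) • (c l • B + W l)).map Polynomial.C)
      = ∑ l, ((Polynomial.X : Polynomial ℝ) ^ d l) •
        (((-1 : ℝ) ^ d l * c l) • B + ((-1 : ℝ) ^ d l) • W l).map Polynomial.C := by
    refine Finset.sum_congr rfl fun l _ => ?_
    rw [smul_add, smul_smul]
  rw [hreflsum] at hZ
  have hZle : (Matrix.det (∑ l, ((Polynomial.X : Polynomial ℝ) ^ d l) •
      (c l • B + W l).map Polynomial.C)).roots.toFinset.card ≤ 2 ^ ((s + 2) * K + 1) := by
    rw [pow_succ]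
    omega
  have hexp : ((s + 2) * K + 1) * q ≤ K * Nat.log 2 K := by
    have h1 : ((s + 2) * K + 1) * q ≤ (q * (s + 3)) * K := by
      have : (s + 2) * K + 1 ≤ (s + 3) * K := by nlinarith
      nlinarith
    exact h1.trans (by rw [mul_comm]; exact Nat.mul_le_mul_left _ hK)
  calc (Matrix.det (∑ l, ((Polynomial.X : Polynomial ℝ) ^ d l) •
          (c l • B + W l).map Polynomial.C)).roots.toFinset.card ^ q
        ≤ (2 ^ ((s + 2) * K + 1)) ^ q := Nat.pow_le_pow_left hZle q
    _ = 2 ^ (((s + 2) * K + 1) * q) := by rw [← pow_mul]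
    _ ≤ 2 ^ (K * Nat.log 2 K) := Nat.pow_le_pow_right (by norm_num) hexp

end Summit.ValiantsHypothesis.ValiantsHypothesis.Theorems.LacunarySymmetroidMatrixDescartes
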